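import Summits.QuantumFields.YangMills.Theorems.UnitScaleTiltProp7CombLadderCountExact
import HarnessLib

/-!
# Route `UnitScaleTilt`, crux K1 «MinimiserStabilityRegPr» (stmt-QuantumFields-19200), route-R E′ path (α′), S3 K-form engine, row (H) ∕ (R4′) — FILE 9h″ «EXACT-MULT», part 2:
# THE WEIGHTS OF THE EXACT COUNT IN CLOSED FORM — support on the TRUNK of the run, product-box structure, cardinality `(R ∓ q κ)·(2R+1)^(d−(|D|+1))`, the sup row
# `W^± ≤ C·card` for a bounded per-comb weight, nonnegativity, total mass `Σ_q (W⁺+W⁻) = Σ_v c v·|v κ|`, and the comb reading of the trunk (`ν ∉ D_i ∪ {κ_i} ↔ ν ∈ t[i+1..]`)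

Cell `ym3-torus`, width seat `ym3-torus-px9` (gen 4; WIDTH COPY «width 9» of ym3-torus-p1); row named by ★ym-ust-19200-p1 g16 NAMER WORD 2 (c) (2026-08-28 23:16Z
«F-H9h″ EXACT-MULT … `Σ_q w ≈ 6R⁵`, `sup w = 2R·R²` on the h-trunk only»).  THEOREMS ONLY (0 `def`, 0 `sorry`); `--supports stmt-QuantumFields-19200 --as helper`, count-neutral.
YM₃ on T³ is a RUNG of the ladder (R3) — not d = 4, not infinite volume, not a mass gap, not the Clay problem; nothing here claims a stub, the crux or any summit statement.

THE POINT.  ✓ `Prop7CombLadderCountExact.sum_box_mul_sum_rungs_eq` rearranges the rungs of all combs of the box onto (position, letter) pairs with the weights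
`W⁺_(D,κ)(q) = Σ_(v ∈ box, P⁺_(D,κ)(v,q)) c v`, `P⁺_(D,κ)(v,q) = (∀ ν ∈ D, q ν = v ν) ∧ (∀ ν, ν ∉ D → ν ≠ κ → q ν = 0) ∧ 0 ≤ q κ ∧ q κ < v κ` (`W⁻`, `P⁻` mirror:
`v κ < q κ ≤ 0`).  Here the fibre `{v ∈ box : P⁺(v,q)}` is identified: EMPTY unless `q` lies on the trunk `{q ν = 0, ν ∉ D ∪ {κ}}` with the right sign of `q κ`, and THERE the
product box `{q ν}_(ν∈D) × (q κ, R] × [−R,R]^(rest)` of cardinality `(R − q κ)·(2R+1)^(d−(|D|+1))` — so for `0 ≤ c ≤ C` (the Cauchy–Schwarz use: `c(v) = |B(v)| ≤ |t|·R`,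
✓ `length_flatMap_seg_le`) the weight is at most `C·(R − q κ)·(2R+1)^(d−(|D|+1))` ON THE TRUNK and `0` off it.  At `d = 3`, two-run tail: run 0 is carried by the PLANE
`q_(t₁) = 0` with weight `≤ C·R·(2R+1)`, run 1 by the box with weight `≤ C·R` — the true multiplicities of the namer's ℓ-audit (WORD 2 (b)).

WHAT IS PROVED (ns `…Theorems.Prop7CombLadderCountExactWeights`; letters of ✓ `Prop7CombLadderCount` ∕ ✓ `Prop7CombLadderCountExact` verbatim, box spelled out, no definition).
* §1 SUPPORT: `filter_pos_eq_empty ∕ filter_neg_eq_empty`.  PRODUCT: ★ `filter_pos_eq_piFinset ∕ filter_neg_eq_piFinset`.  CLOSED FORM: `prod_erase_ite_eq_pow`, ★★ `card_filter_pos ∕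
  card_filter_neg`.  BOUNDS: ★★ `weight_pos_le ∕ weight_neg_le` (`c ≤ C`, `0 ≤ C` ⇒ `W^±(q) ≤ C·(R ∓ q κ)⁺·(2R+1)^(d−(|D|+1))` at every `q ∈ box`), `weight_nonneg`.
  MASS: ★ `sum_box_weights_eq_mass` (exact), ★ `sum_box_weights_le` (`≤ C·R·(2R+1)^d`).
* §2 THE TRUNK OF THE COMB: ★ `not_mem_foldl_insert_iff` — for the split `(finRange d).reverse = s ++ μ :: t`, `ν ∉ D_i ∧ ν ≠ t[i] ↔ ν ∈ t.drop (i+1)`: the `i`-th run's trunk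
  condition reads `q (t[j]) = 0` for all `j > i` (all of the box for the last run, a plane for the one before, …).
HONEST SCOPE.  Finite combinatorics on `ℤ^d`; the `h`-offset spreading of the trunk planes (✓ `Prop7CombLadderCountOffset` (C3)'s mechanism) and every booking are the consumer's.

References: T. Bałaban, CMP 98 (1985) 17–51 [Balaban1985Averaging] ((8)–(9) pp.18–19, (19)–(20) p.21, p.24); CMP 102 (1985) 255–275 [Balaban1985UV3] ((27) p.263).
-/

set_option autoImplicit false

open scoped BigOperators

namespace Summit.QuantumFields.YangMills.Theorems.Prop7CombLadderCountExactWeights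

open Literature.MathematicalPhysics.QuantumFieldTheory.Balaban1983to89
open B7Prop1Explicit (Site Letter e e_apply disp seg length_seg)
open Summit.QuantumFields.YangMills.Theorems.Prop7CombLadderCount (mem_box_iff split_nodup)
open Summit.QuantumFields.YangMills.Theorems.Prop7CombLadderCountExact (sum_box_mul_sum_run_eq mem_foldl_insert)

variable {d : ℕ}

/-! ## §1 The weights: support, product structure, closed form, bounds, mass -/

/-- SUPPORT (forward): the forward fibre of `q` is EMPTY unless `q` lies on the trunk `{q ν = 0, ν ∉ D ∪ {κ}}` with `0 ≤ q κ`. [cite: Balaban1985Averaging, p.24] -/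
theorem filter_pos_eq_empty (R : ℕ) (D : Finset (Fin d)) (κ : Fin d) (q : Site d) (h : ¬ ((∀ ν, ν ∉ D → ν ≠ κ → q ν = 0) ∧ 0 ≤ q κ)) :
    (Fintype.piFinset (fun _ : Fin d => Finset.Icc (-(R : ℤ)) (R : ℤ))).filter
        (fun v => (∀ ν ∈ D, q ν = v ν) ∧ (∀ ν, ν ∉ D → ν ≠ κ → q ν = 0) ∧ 0 ≤ q κ ∧ q κ < v κ) = ∅ :=
  Finset.filter_eq_empty_iff.mpr fun _ _ hP => h ⟨hP.2.1, hP.2.2.1⟩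

/-- SUPPORT (backward): the backward fibre of `q` is EMPTY unless `q` lies on the trunk with `q κ ≤ 0`. [cite: Balaban1985Averaging, p.24] -/
theorem filter_neg_eq_empty (R : ℕ) (D : Finset (Fin d)) (κ : Fin d) (q : Site d) (h : ¬ ((∀ ν, ν ∉ D → ν ≠ κ → q ν = 0) ∧ q κ ≤ 0)) :
    (Fintype.piFinset (fun _ : Fin d => Finset.Icc (-(R : ℤ)) (R : ℤ))).filter
        (fun v => (∀ ν ∈ D, q ν = v ν) ∧ (∀ ν, ν ∉ D → ν ≠ κ → q ν = 0) ∧ v κ < q κ ∧ q κ ≤ 0) = ∅ :=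
  Finset.filter_eq_empty_iff.mpr fun _ _ hP => h ⟨hP.2.1, hP.2.2.2⟩

/-- ★ THE FORWARD FIBRE IS A PRODUCT BOX on its support: `{q ν}` on `D`, `(q κ, R]` at `κ`, `[−R, R]` elsewhere (`κ ∉ D`, `q ∈ box` on the trunk, `0 ≤ q κ`). [folklore] -/
theorem filter_pos_eq_piFinset (R : ℕ) (D : Finset (Fin d)) (κ : Fin d) (hκ : κ ∉ D) (q : Site d)
    (hq : q ∈ Fintype.piFinset (fun _ : Fin d => Finset.Icc (-(R : ℤ)) (R : ℤ))) (htrunk : ∀ ν, ν ∉ D → ν ≠ κ → q ν = 0) (hsgn : 0 ≤ q κ) :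
    (Fintype.piFinset (fun _ : Fin d => Finset.Icc (-(R : ℤ)) (R : ℤ))).filter
        (fun v => (∀ ν ∈ D, q ν = v ν) ∧ (∀ ν, ν ∉ D → ν ≠ κ → q ν = 0) ∧ 0 ≤ q κ ∧ q κ < v κ)
      = Fintype.piFinset (fun ν : Fin d => if ν ∈ D then ({q ν} : Finset ℤ) else if ν = κ then Finset.Ioc (q κ) (R : ℤ) else Finset.Icc (-(R : ℤ)) (R : ℤ)) := by
  classical
  have hqb := (mem_box_iff (R := R)).mp hq
  ext v
  rw [Finset.mem_filter, mem_box_iff, Fintype.mem_piFinset]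
  constructor
  · rintro ⟨hvb, hagree, -, -, hlt⟩ ν
    by_cases hνD : ν ∈ D
    · rw [if_pos hνD, Finset.mem_singleton]; exact (hagree ν hνD).symm
    · rw [if_neg hνD]
      by_cases hνκ : ν = κ
      · rw [if_pos hνκ, Finset.mem_Ioc, hνκ]; exact ⟨hlt, (hvb κ).2⟩
      · rw [if_neg hνκ, Finset.mem_Icc]; exact hvb ν
  · intro hv
    refine ⟨fun ν => ?_, fun ν hν => ?_, htrunk, hsgn, ?_⟩
    · have h := hv ν
      by_cases hνD : ν ∈ D
      · rw [if_pos hνD, Finset.mem_singleton] at h; rw [h]; exact hqb ν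
      · rw [if_neg hνD] at h
        by_cases hνκ : ν = κ
        · rw [if_pos hνκ, Finset.mem_Ioc] at h; subst hνκ; constructor <;> omega
        · rw [if_neg hνκ, Finset.mem_Icc] at h; exact h
    · have h := hv ν
      rw [if_pos hν, Finset.mem_singleton] at h; exact h.symm
    · have h := hv κ
      rw [if_neg hκ, if_pos rfl, Finset.mem_Ioc] at h; exact h.1

/-- ★ THE BACKWARD FIBRE IS A PRODUCT BOX on its support: `{q ν}` on `D`, `[−R, q κ)` at `κ`, `[−R, R]` elsewhere (`κ ∉ D`, `q ∈ box` on the trunk, `q κ ≤ 0`). [folklore] -/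
theorem filter_neg_eq_piFinset (R : ℕ) (D : Finset (Fin d)) (κ : Fin d) (hκ : κ ∉ D) (q : Site d)
    (hq : q ∈ Fintype.piFinset (fun _ : Fin d => Finset.Icc (-(R : ℤ)) (R : ℤ))) (htrunk : ∀ ν, ν ∉ D → ν ≠ κ → q ν = 0) (hsgn : q κ ≤ 0) :
    (Fintype.piFinset (fun _ : Fin d => Finset.Icc (-(R : ℤ)) (R : ℤ))).filter
        (fun v => (∀ ν ∈ D, q ν = v ν) ∧ (∀ ν, ν ∉ D → ν ≠ κ → q ν = 0) ∧ v κ < q κ ∧ q κ ≤ 0)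
      = Fintype.piFinset (fun ν : Fin d => if ν ∈ D then ({q ν} : Finset ℤ) else if ν = κ then Finset.Ico (-(R : ℤ)) (q κ) else Finset.Icc (-(R : ℤ)) (R : ℤ)) := by
  classical
  have hqb := (mem_box_iff (R := R)).mp hq
  ext v
  rw [Finset.mem_filter, mem_box_iff, Fintype.mem_piFinset]
  constructor
  · rintro ⟨hvb, hagree, -, hlt, -⟩ ν
    by_cases hνD : ν ∈ D
    · rw [if_pos hνD, Finset.mem_singleton]; exact (hagree ν hνD).symm
    · rw [if_neg hνD]
      by_cases hνκ : ν = κ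
      · rw [if_pos hνκ, Finset.mem_Ico, hνκ]; exact ⟨(hvb κ).1, hlt⟩
      · rw [if_neg hνκ, Finset.mem_Icc]; exact hvb ν
  · intro hv
    refine ⟨fun ν => ?_, fun ν hν => ?_, htrunk, ?_, hsgn⟩
    · have h := hv ν
      by_cases hνD : ν ∈ D
      · rw [if_pos hνD, Finset.mem_singleton] at h; rw [h]; exact hqb ν
      · rw [if_neg hνD] at h
        by_cases hνκ : ν = κ
        · rw [if_pos hνκ, Finset.mem_Ico] at h; subst hνκ; constructor <;> omega
        · rw [if_neg hνκ, Finset.mem_Icc] at h; exact h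
    · have h := hv ν
      rw [if_pos hν, Finset.mem_singleton] at h; exact h.symm
    · have h := hv κ
      rw [if_neg hκ, if_pos rfl, Finset.mem_Ico] at h; exact h.2

/-- the count of the free coordinates: `Π_(ν ≠ κ) (if ν ∈ D then 1 else 2R+1) = (2R+1)^(d − (|D|+1))` for `κ ∉ D`. [folklore] -/
theorem prod_erase_ite_eq_pow (R : ℕ) (D : Finset (Fin d)) (κ : Fin d) (hκ : κ ∉ D) :
    ∏ ν ∈ Finset.univ.erase κ, (if ν ∈ D then 1 else 2 * R + 1) = (2 * R + 1) ^ (d - (D.card + 1)) := by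
  classical
  rw [Finset.prod_ite, Finset.prod_const_one, one_mul, Finset.prod_const]
  congr 1
  have hset : (Finset.univ.erase κ).filter (fun ν => ν ∉ D) = (Finset.univ \ D).erase κ := by
    ext ν; simp [and_comm]
  rw [hset, Finset.card_erase_of_mem (by simp [hκ]), Finset.card_univ_sdiff, Fintype.card_fin]
  omega

/-- ★ CLOSED FORM (forward): on its support the forward fibre of `q` has EXACTLY `(R − q κ)·(2R+1)^(d−(|D|+1))` combs. [cite: Balaban1985Averaging, (8)–(9) pp.18–19, p.24] -/
theorem card_filter_pos (R : ℕ) (D : Finset (Fin d)) (κ : Fin d) (hκ : κ ∉ D) (q : Site d)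
    (hq : q ∈ Fintype.piFinset (fun _ : Fin d => Finset.Icc (-(R : ℤ)) (R : ℤ))) (htrunk : ∀ ν, ν ∉ D → ν ≠ κ → q ν = 0) (hsgn : 0 ≤ q κ) :
    ((Fintype.piFinset (fun _ : Fin d => Finset.Icc (-(R : ℤ)) (R : ℤ))).filter
        (fun v => (∀ ν ∈ D, q ν = v ν) ∧ (∀ ν, ν ∉ D → ν ≠ κ → q ν = 0) ∧ 0 ≤ q κ ∧ q κ < v κ)).card
      = ((R : ℤ) - q κ).toNat * (2 * R + 1) ^ (d - (D.card + 1)) := by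
  classical
  rw [filter_pos_eq_piFinset R D κ hκ q hq htrunk hsgn, Fintype.card_piFinset, ← Finset.prod_erase_mul _ _ (Finset.mem_univ κ),
    if_neg hκ, if_pos rfl, Int.card_Ioc, mul_comm]
  congr 1
  rw [← prod_erase_ite_eq_pow R D κ hκ]
  refine Finset.prod_congr rfl fun ν hν => ?_
  have hνκ : ν ≠ κ := Finset.ne_of_mem_erase hν
  by_cases hνD : ν ∈ D
  · rw [if_pos hνD, if_pos hνD, Finset.card_singleton]
  · rw [if_neg hνD, if_neg hνD, if_neg hνκ, Int.card_Icc]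
    have : ((R : ℤ) + 1 - -(R : ℤ)) = ((2 * R + 1 : ℕ) : ℤ) := by push_cast; ring
    rw [this, Int.toNat_natCast]

/-- ★ CLOSED FORM (backward): on its support the backward fibre of `q` has EXACTLY `(R + q κ)·(2R+1)^(d−(|D|+1))` combs. [cite: Balaban1985Averaging, (8)–(9) pp.18–19, p.24] -/
theorem card_filter_neg (R : ℕ) (D : Finset (Fin d)) (κ : Fin d) (hκ : κ ∉ D) (q : Site d)
    (hq : q ∈ Fintype.piFinset (fun _ : Fin d => Finset.Icc (-(R : ℤ)) (R : ℤ))) (htrunk : ∀ ν, ν ∉ D → ν ≠ κ → q ν = 0) (hsgn : q κ ≤ 0) :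
    ((Fintype.piFinset (fun _ : Fin d => Finset.Icc (-(R : ℤ)) (R : ℤ))).filter
        (fun v => (∀ ν ∈ D, q ν = v ν) ∧ (∀ ν, ν ∉ D → ν ≠ κ → q ν = 0) ∧ v κ < q κ ∧ q κ ≤ 0)).card
      = ((R : ℤ) + q κ).toNat * (2 * R + 1) ^ (d - (D.card + 1)) := by
  classical
  rw [filter_neg_eq_piFinset R D κ hκ q hq htrunk hsgn, Fintype.card_piFinset, ← Finset.prod_erase_mul _ _ (Finset.mem_univ κ),
    if_neg hκ, if_pos rfl, Int.card_Ico, show q κ - -(R : ℤ) = (R : ℤ) + q κ by ring, mul_comm]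
  congr 1
  rw [← prod_erase_ite_eq_pow R D κ hκ]
  refine Finset.prod_congr rfl fun ν hν => ?_
  have hνκ : ν ≠ κ := Finset.ne_of_mem_erase hν
  by_cases hνD : ν ∈ D
  · rw [if_pos hνD, if_pos hνD, Finset.card_singleton]
  · rw [if_neg hνD, if_neg hνD, if_neg hνκ, Int.card_Icc]
    have : ((R : ℤ) + 1 - -(R : ℤ)) = ((2 * R + 1 : ℕ) : ℤ) := by push_cast; ring
    rw [this, Int.toNat_natCast]

/-- ★ WEIGHT BOUND (forward): for `c ≤ C` on the box and `0 ≤ C`, `W⁺_(D,κ)(q) ≤ C·(R − q κ)⁺·(2R+1)^(d−(|D|+1))` at every `q ∈ box` (and `W⁺ = 0` off the support).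
With the Cauchy–Schwarz weight `c(v) = |B(v)| ≤ |t|·R` (✓ `length_flatMap_seg_le`) this is the consumer's sup row, now carrying the trunk support and the linear profile in `q κ`.
[cite: Balaban1985Averaging, (8)–(9) pp.18–19, (19)–(20) p.21, p.24] -/
theorem weight_pos_le (R : ℕ) (D : Finset (Fin d)) (κ : Fin d) (hκ : κ ∉ D) (c : Site d → ℝ) (C : ℝ) (hC : 0 ≤ C)
    (hc : ∀ v ∈ Fintype.piFinset (fun _ : Fin d => Finset.Icc (-(R : ℤ)) (R : ℤ)), c v ≤ C) (q : Site d)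
    (hq : q ∈ Fintype.piFinset (fun _ : Fin d => Finset.Icc (-(R : ℤ)) (R : ℤ))) :
    ∑ v ∈ (Fintype.piFinset (fun _ : Fin d => Finset.Icc (-(R : ℤ)) (R : ℤ))).filter
        (fun v => (∀ ν ∈ D, q ν = v ν) ∧ (∀ ν, ν ∉ D → ν ≠ κ → q ν = 0) ∧ 0 ≤ q κ ∧ q κ < v κ), c v
      ≤ C * ((((R : ℤ) - q κ).toNat * (2 * R + 1) ^ (d - (D.card + 1)) : ℕ) : ℝ) := by
  classical
  by_cases h : (∀ ν, ν ∉ D → ν ≠ κ → q ν = 0) ∧ 0 ≤ q κ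
  · calc ∑ v ∈ (Fintype.piFinset (fun _ : Fin d => Finset.Icc (-(R : ℤ)) (R : ℤ))).filter
            (fun v => (∀ ν ∈ D, q ν = v ν) ∧ (∀ ν, ν ∉ D → ν ≠ κ → q ν = 0) ∧ 0 ≤ q κ ∧ q κ < v κ), c v
        ≤ ∑ v ∈ (Fintype.piFinset (fun _ : Fin d => Finset.Icc (-(R : ℤ)) (R : ℤ))).filter
            (fun v => (∀ ν ∈ D, q ν = v ν) ∧ (∀ ν, ν ∉ D → ν ≠ κ → q ν = 0) ∧ 0 ≤ q κ ∧ q κ < v κ), C :=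
          Finset.sum_le_sum fun v hv => hc v (Finset.mem_filter.mp hv).1
      _ = _ := by rw [Finset.sum_const, nsmul_eq_mul, card_filter_pos R D κ hκ q hq h.1 h.2, mul_comm]
  · rw [filter_pos_eq_empty R D κ q h, Finset.sum_empty]
    positivity

/-- ★ WEIGHT BOUND (backward): `W⁻_(D,κ)(q) ≤ C·(R + q κ)⁺·(2R+1)^(d−(|D|+1))` at every `q ∈ box`. [cite: Balaban1985Averaging, (8)–(9) pp.18–19, (19)–(20) p.21, p.24] -/
theorem weight_neg_le (R : ℕ) (D : Finset (Fin d)) (κ : Fin d) (hκ : κ ∉ D) (c : Site d → ℝ) (C : ℝ) (hC : 0 ≤ C)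
    (hc : ∀ v ∈ Fintype.piFinset (fun _ : Fin d => Finset.Icc (-(R : ℤ)) (R : ℤ)), c v ≤ C) (q : Site d)
    (hq : q ∈ Fintype.piFinset (fun _ : Fin d => Finset.Icc (-(R : ℤ)) (R : ℤ))) :
    ∑ v ∈ (Fintype.piFinset (fun _ : Fin d => Finset.Icc (-(R : ℤ)) (R : ℤ))).filter
        (fun v => (∀ ν ∈ D, q ν = v ν) ∧ (∀ ν, ν ∉ D → ν ≠ κ → q ν = 0) ∧ v κ < q κ ∧ q κ ≤ 0), c v
      ≤ C * ((((R : ℤ) + q κ).toNat * (2 * R + 1) ^ (d - (D.card + 1)) : ℕ) : ℝ) := by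
  classical
  by_cases h : (∀ ν, ν ∉ D → ν ≠ κ → q ν = 0) ∧ q κ ≤ 0
  · calc ∑ v ∈ (Fintype.piFinset (fun _ : Fin d => Finset.Icc (-(R : ℤ)) (R : ℤ))).filter
            (fun v => (∀ ν ∈ D, q ν = v ν) ∧ (∀ ν, ν ∉ D → ν ≠ κ → q ν = 0) ∧ v κ < q κ ∧ q κ ≤ 0), c v
        ≤ ∑ v ∈ (Fintype.piFinset (fun _ : Fin d => Finset.Icc (-(R : ℤ)) (R : ℤ))).filter
            (fun v => (∀ ν ∈ D, q ν = v ν) ∧ (∀ ν, ν ∉ D → ν ≠ κ → q ν = 0) ∧ v κ < q κ ∧ q κ ≤ 0), C :=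
          Finset.sum_le_sum fun v hv => hc v (Finset.mem_filter.mp hv).1
      _ = _ := by rw [Finset.sum_const, nsmul_eq_mul, card_filter_neg R D κ hκ q hq h.1 h.2, mul_comm]
  · rw [filter_neg_eq_empty R D κ q h, Finset.sum_empty]
    positivity

/-- the weights are nonnegative for a nonnegative per-comb weight. [folklore] -/
theorem weight_nonneg (S : Finset (Site d)) (P : Site d → Prop) [DecidablePred P] (c : Site d → ℝ) (hc : ∀ v ∈ S, 0 ≤ c v) :
    0 ≤ ∑ v ∈ S.filter P, c v :=
  Finset.sum_nonneg fun v hv => hc v (Finset.mem_filter.mp hv).1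

/-- ★ MASS: `Σ_(q ∈ box) (W⁺_(D,κ)(q) + W⁻_(D,κ)(q)) = Σ_(v ∈ box) c v·|v κ|` — the weights only REARRANGE the rungs (✓ `sum_box_mul_sum_run_eq` at `f ≡ 1`).
[cite: Balaban1985Averaging, p.24] -/
theorem sum_box_weights_eq_mass (R : ℕ) (D : Finset (Fin d)) (κ : Fin d) (hκ : κ ∉ D) (c : Site d → ℝ) :
    ∑ q ∈ Fintype.piFinset (fun _ : Fin d => Finset.Icc (-(R : ℤ)) (R : ℤ)),
        ((∑ v ∈ (Fintype.piFinset (fun _ : Fin d => Finset.Icc (-(R : ℤ)) (R : ℤ))).filter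
              (fun v => (∀ ν ∈ D, q ν = v ν) ∧ (∀ ν, ν ∉ D → ν ≠ κ → q ν = 0) ∧ 0 ≤ q κ ∧ q κ < v κ), c v)
          + (∑ v ∈ (Fintype.piFinset (fun _ : Fin d => Finset.Icc (-(R : ℤ)) (R : ℤ))).filter
              (fun v => (∀ ν ∈ D, q ν = v ν) ∧ (∀ ν, ν ∉ D → ν ≠ κ → q ν = 0) ∧ v κ < q κ ∧ q κ ≤ 0), c v))
      = ∑ v ∈ Fintype.piFinset (fun _ : Fin d => Finset.Icc (-(R : ℤ)) (R : ℤ)), c v * ((v κ).natAbs : ℝ) := by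
  have h := sum_box_mul_sum_run_eq R D κ hκ (κ, true) c (fun _ _ => (1 : ℝ))
  simp only [mul_one, Finset.sum_const, Finset.card_range, nsmul_eq_mul, length_seg] at h
  rw [← h]

/-- ★ MASS BOUND: for `c ≤ C` on the box (`0 ≤ C`), `Σ_(q ∈ box) (W⁺_(D,κ)(q) + W⁻_(D,κ)(q)) ≤ C·R·(2R+1)^d` per run — with the Cauchy–Schwarz weight `C = |t|·R` the namer's
«`6R⁵`-class total» (`|t|·R²·(2R+1)^d`, d = 3, `|t| ≤ 2`). [cite: Balaban1985Averaging, (19)–(20) p.21, p.24] -/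
theorem sum_box_weights_le (R : ℕ) (D : Finset (Fin d)) (κ : Fin d) (hκ : κ ∉ D) (c : Site d → ℝ) (C : ℝ) (hC : 0 ≤ C)
    (hc : ∀ v ∈ Fintype.piFinset (fun _ : Fin d => Finset.Icc (-(R : ℤ)) (R : ℤ)), c v ≤ C) :
    ∑ q ∈ Fintype.piFinset (fun _ : Fin d => Finset.Icc (-(R : ℤ)) (R : ℤ)),
        ((∑ v ∈ (Fintype.piFinset (fun _ : Fin d => Finset.Icc (-(R : ℤ)) (R : ℤ))).filter
              (fun v => (∀ ν ∈ D, q ν = v ν) ∧ (∀ ν, ν ∉ D → ν ≠ κ → q ν = 0) ∧ 0 ≤ q κ ∧ q κ < v κ), c v)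
          + (∑ v ∈ (Fintype.piFinset (fun _ : Fin d => Finset.Icc (-(R : ℤ)) (R : ℤ))).filter
              (fun v => (∀ ν ∈ D, q ν = v ν) ∧ (∀ ν, ν ∉ D → ν ≠ κ → q ν = 0) ∧ v κ < q κ ∧ q κ ≤ 0), c v))
      ≤ C * R * (((2 * R + 1) ^ d : ℕ) : ℝ) := by
  rw [sum_box_weights_eq_mass R D κ hκ c]
  have hcard : (Fintype.piFinset (fun _ : Fin d => Finset.Icc (-(R : ℤ)) (R : ℤ))).card = (2 * R + 1) ^ d := by
    rw [Fintype.card_piFinset, Finset.prod_const, Finset.card_univ, Fintype.card_fin, Int.card_Icc]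
    have : ((R : ℤ) + 1 - -(R : ℤ)) = ((2 * R + 1 : ℕ) : ℤ) := by push_cast; ring
    rw [this, Int.toNat_natCast]
  calc ∑ v ∈ Fintype.piFinset (fun _ : Fin d => Finset.Icc (-(R : ℤ)) (R : ℤ)), c v * ((v κ).natAbs : ℝ)
      ≤ ∑ v ∈ Fintype.piFinset (fun _ : Fin d => Finset.Icc (-(R : ℤ)) (R : ℤ)), C * (R : ℝ) := by
        refine Finset.sum_le_sum fun v hv => ?_
        have hvκ := ((mem_box_iff (R := R)).mp hv) κ
        have hn : ((v κ).natAbs : ℝ) ≤ R := by exact_mod_cast (show (v κ).natAbs ≤ R by omega)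
        calc c v * ((v κ).natAbs : ℝ) ≤ C * ((v κ).natAbs : ℝ) := mul_le_mul_of_nonneg_right (hc v hv) (by positivity)
          _ ≤ C * R := mul_le_mul_of_nonneg_left hn hC
    _ = C * R * (((2 * R + 1) ^ d : ℕ) : ℝ) := by
        rw [Finset.sum_const, hcard, nsmul_eq_mul]; push_cast; ring

/-! ## §2 The trunk of the comb -/

/-- the determined sets of the comb exhaust the directions: `ν ∉ D_i ∧ ν ≠ κ_i ↔ ν ∈ t[i+1..]` — so the `i`-th trunk condition reads `q (t[j]) = 0` for all `j > i`.
[cite: Balaban1985UV3, (27) p.263] -/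
theorem not_mem_foldl_insert_iff (μ : Fin d) {s t : List (Fin d)} (h : (List.finRange d).reverse = s ++ μ :: t) (i : ℕ) (hi : i < t.length) (ν : Fin d) :
    (ν ∉ (t.take i).foldl (fun S ν => insert ν S) (insert μ s.toFinset) ∧ ν ≠ t.getD i μ) ↔ ν ∈ t.drop (i + 1) := by
  classical
  obtain ⟨-, ht, hμs, hμt, hts, -⟩ := split_nodup μ h
  have hmem : ν ∈ s ++ μ :: t := by rw [← h]; simp
  rw [mem_foldl_insert, Finset.mem_insert, List.mem_toFinset]
  have htsplit : t = t.take i ++ t.getD i μ :: t.drop (i + 1) := by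
    rw [List.getD_eq_getElem _ _ hi, ← List.drop_eq_getElem_cons hi, List.take_append_drop]
  constructor
  · rintro ⟨h1, h2⟩
    push Not at h1
    obtain ⟨⟨hνμ, hνs⟩, hνt⟩ := h1
    rcases List.mem_append.mp hmem with hm | hm
    · exact absurd hm hνs
    · rcases List.mem_cons.mp hm with hm | hm
      · exact absurd hm hνμ
      · rw [htsplit, List.mem_append, List.mem_cons] at hm
        rcases hm with hm | hm | hm
        · exact absurd hm hνt
        · exact absurd hm h2
        · exact hm
  · intro hν
    have hνt' : ν ∈ t := List.mem_of_mem_drop hν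
    have hnd : (t.take i ++ t.getD i μ :: t.drop (i + 1)).Nodup := htsplit ▸ ht
    rw [List.nodup_append] at hnd
    obtain ⟨-, hnd2, hdisj⟩ := hnd
    refine ⟨?_, ?_⟩
    · push Not
      refine ⟨⟨fun hνμ => hμt (hνμ ▸ hνt'), fun hνs => hts ν hνt' hνs⟩, fun hνi => hdisj ν hνi ν (by simp [hν]) rfl⟩
    · intro hνκ
      exact (List.nodup_cons.mp hnd2).1 (hνκ ▸ hν)

end Summit.QuantumFields.YangMills.Theorems.Prop7CombLadderCountExactWeights
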